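import Summits.ResolutionOfSingularities.ResolutionOfSingularities.Theorems.WildConesCampaignW46ForcedAtomsRegime
import Summits.ResolutionOfSingularities.ResolutionOfSingularities.Theorems.WildConesCampaignW46ForcedAtomsFiniteSingRat
import HarnessLib

/-!
# [OURS · L1 W4.6, rung (i) SURFACES IN 3-SPACE / CURVES IN THE PLANE, GEOMETRIC FORM — brick 40] The named rungs
# `ForcedAtomsFin{FinLocalExitBound,PermissiblyTerminates,Terminates} p K n` CLOSED BY NAME over every FINITE field
# (`n = 2` and `n = 1`, every `p`)

Cell res-hironaka (LADDER-RESOLUTION rung L, D-0089), slot W4.6 «restricted regimes as rungs», seat res-L1-s46-pv-2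
(gen 5). Host: route `WildCones`, crux `ClassicalRegimes` (stmt-ResolutionOfSingularities-16884),
`--supports … --as helper`.

HONEST FRAMING. Everything here is OURS; one-line closers of the named rungs of `…W46ForcedAtomsRegime.lean` (p552891)
over FINITE fields by brick 39 (`finLocalExitBound_of_le_forcedAtoms{Surface,Curve}_of_finite`). Finite fields are the
setting of the slot's kill test K4.6 (res-L0-k46: the cusp family over prime fields). NOTHING here is a statement of
H. Hironaka's manuscript [Hironaka2017]; no FACT-LIST premise. AI review is weaker than expert review.

## What is proved (`K` a FINITE field of characteristic `p`, every prime `p`)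

* `forcedAtomsFinFinLocalExitBound_two_of_finite` / `_one_of_finite` — `ForcedAtomsFinFinLocalExitBound p K 2` and
  `… p K 1`;
* `forcedAtomsFinPermissiblyTerminates_{two,one}_of_finite`, `forcedAtomsFinTerminates_{two,one}_of_finite`.

References: brick 39 and the regime file of this seat; H. Hironaka, ms. 2017, Th. 16.6 p.84 — ROLE only, under
adjudication, not cited as fact. [folklore]
-/

noncomputable section

-- single-problem summit: the doubled namespace component `ResolutionOfSingularities` is forced
set_option linter.dupNamespace false

open scoped BigOperators Classical
open MvPowerSeries IsLocalRing

namespace Summit.ResolutionOfSingularities.ResolutionOfSingularities.Theorems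

namespace CampaignW46

open CategoryTheory AlgebraicGeometry TopologicalSpace
open Literature.AlgebraicGeometry.Resolution
open Literature.AlgebraicGeometry.Hironaka2017.S02Preliminaries
open Scheme.IdealSheafData
open WildCones

variable {p : ℕ} [Fact p.Prime] {K : Type} [Field K] [CharP K p]

/-- [OURS · L1 W4.6 rung (i) SURFACES IN 3-SPACE, geometric form, over every FINITE field — CLOSED BY NAME; NOT a
statement of the manuscript] `ForcedAtomsFinFinLocalExitBound p K 2` holds for finite `K` (brick 39 at the named regime
with the identity inclusion). [folklore] -/
theorem forcedAtomsFinFinLocalExitBound_two_of_finite (hK : Finite K) : ForcedAtomsFinFinLocalExitBound p K 2 := by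
  haveI := hK
  exact ForcedAtom.finLocalExitBound_of_le_forcedAtomsSurface_of_finite hK _ fun _ _ h => h

/-- [OURS · L1 W4.6 rung (i) CURVES IN THE PLANE, geometric form, over every FINITE field — CLOSED BY NAME; NOT a
statement of the manuscript] `ForcedAtomsFinFinLocalExitBound p K 1` holds for finite `K`. [folklore] -/
theorem forcedAtomsFinFinLocalExitBound_one_of_finite (hK : Finite K) : ForcedAtomsFinFinLocalExitBound p K 1 := by
  haveI := hK
  exact ForcedAtom.finLocalExitBound_of_le_forcedAtomsCurve_of_finite hK _ fun _ _ h => h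

/-- [OURS · L1 W4.6; NOT a statement of the manuscript] The résumé-free rung for surfaces over a finite field, by name.
[folklore] -/
theorem forcedAtomsFinPermissiblyTerminates_two_of_finite (hK : Finite K) : ForcedAtomsFinPermissiblyTerminates p K 2 :=
  forcedAtomsFinPermissiblyTerminates_of_finLocalExitBound (forcedAtomsFinFinLocalExitBound_two_of_finite hK)

/-- [OURS · L1 W4.6; NOT a statement of the manuscript] The résumé-free rung for curves over a finite field, by name.
[folklore] -/
theorem forcedAtomsFinPermissiblyTerminates_one_of_finite (hK : Finite K) : ForcedAtomsFinPermissiblyTerminates p K 1 :=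
  forcedAtomsFinPermissiblyTerminates_of_finLocalExitBound (forcedAtomsFinFinLocalExitBound_one_of_finite hK)

/-- [OURS · L1 W4.6; NOT a statement of the manuscript] The typed rung for surfaces over a finite field, by name (every
`m`, `N`, `Rd`). [folklore] -/
theorem forcedAtomsFinTerminates_two_of_finite (hK : Finite K) : ForcedAtomsFinTerminates p K 2 :=
  forcedAtomsFinTerminates_of_permissibly (forcedAtomsFinPermissiblyTerminates_two_of_finite hK)

/-- [OURS · L1 W4.6; NOT a statement of the manuscript] The typed rung for curves over a finite field, by name. [folklore] -/
theorem forcedAtomsFinTerminates_one_of_finite (hK : Finite K) : ForcedAtomsFinTerminates p K 1 :=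
  forcedAtomsFinTerminates_of_permissibly (forcedAtomsFinPermissiblyTerminates_one_of_finite hK)

end CampaignW46

end Summit.ResolutionOfSingularities.ResolutionOfSingularities.Theorems

end
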